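import Mathlib
import HarnessLib
import Literature.Probability.MarkovChains.GroupRandomWalk
import Literature.Probability.MarkovChains.ReplicaExchange

/-!
# Crooks' path-ensemble average for driven Markov dynamics: microscopic reversibility, the Jarzynski relation and the transient (work) fluctuation theorem

HONEST FRAMING: exact (Metropolis-corrected) sampling algorithms for lattice gauge theory; figures
of merit are autocorrelation/cost numbers at stated couplings and volumes; no continuum-physics claim.

Source: G. E. Crooks, *Path-ensemble averages in systems driven far from equilibrium*, Phys. Rev.
E 61 (2000) 2361–2366 = cond-mat/9908420 [Crooks2000] (held text `paper:arxiv-cond-mat_9908420`;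
§II = chunks p0004–p0006, §III = p0007–p0009; equation numbers (1)–(23) are those of the arXiv
source, counted in order).  The setting of §II is FINITE and DISCRETE as printed ("a classical
system which can exchange energy with a constant temperature heat bath, and which has a finite set
of states, `x ∈ {1,2,3,⋯,N}` … a stochastic dynamics with a discrete time scale,
`t ∈ {0,1,2,3,⋯,τ}`"), so everything below is PROVED by finite sums (0 named facts).

CONVENTIONS.  Crooks writes column-stochastic matrices `M(t)_{x(t+1) x(t)} = P(x(t) → x(t+1))`
(eq. (3)); this file uses the tree's row convention `K t x y = P(x(t) = x → x(t+1) = y)`, so "`M` is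
balanced, `π(t) = M(t)π(t)`" is the tree's `IsStationary (π t) (K t)` and the time reversal
`M̂ = diag(π)⁻¹ Mᵀ diag(π)` (eq. (9)) is the tree's `timeReversal π (K t)` of
`GroupRandomWalk.lean` (`P̂(x,y) = π(y)P(y,x)/π(x)`, [LevinPeres2017] eq. (1.32)).  The Boltzmann
weight `e^{−βE_x}` is the tree's `ReplicaExchange.boltzmann E β x`.  A path is
`x : Fin (τ+1) → X`, `x t` = the state at time `t`; the state energies at time `t` are `E t : X → ℝ`
(`E : Fin (τ+1) → X → ℝ`); the step `t → t+1` (`t : Fin τ`) is the move with `K t`, balanced with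
respect to the canonical law of the CURRENT energies `E t` ("In the first substep the system makes a
stochastic transition … In the second substep the state energies change from `E(t)` to `E(t+1)`").

* §II: `canonicalZ β E = Σ_x e^{−βE_x}`, **(2)** `canonicalLaw β E x = ρ(x|β,E) = e^{−βE_x}/Z`,
  `helmholtzF β E = F(β,E) = −β⁻¹ ln Σ_x e^{−βE_x}` (`canonicalLaw_eq_exp`: `ρ = exp{βF − βE_x}`);
  `pathProb K x = 𝒫[x | x(0), M] = Π_{t<τ} P(x(t) → x(t+1))` (eqs. (3)–(4) and "expanding the path
  probability as a product of single time step transition probabilities"); **(6)** `heat E x = 𝒬[x]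
  = Σ_{t<τ} [E(t)_{x(t+1)} − E(t)_{x(t)}]`, **(7)** `work E x = 𝒲[x] = Σ_{t<τ} [E(t+1)_{x(t+1)} −
  E(t)_{x(t+1)}]`, **(8)** `Crooks2000_eq_8`: `ΔE = E(τ)_{x(τ)} − E(0)_{x(0)} = 𝒲 + 𝒬`;
  the time reversal `reversePath x = x̂` (`x̂(t) = x(τ−t)`), `reverseEnergies E = Ê`
  (`Ê(t) = E(τ−t)`), **(10)** `reverseProtocol β E K = M̂` (`M̂` at reverse step `s` is the time
  reversal of `M(τ−1−s)` w.r.t. `π(τ−1−s)`; "`M̂(t)` is the transition matrix from time `t−1` to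
  time `t`"), `reverseProtocol_isRowStochastic` ("it is easy to confirm that `M̂` is a transition
  matrix"), `reverseProtocol_isStationary` ("`M̂` and `M` have the same invariant distribution"),
  `reverseProtocol_eq_self_of_detailedBalance` ("If the transition matrix obeys detailed balance …
  then `M̂ = M`"); the work and heat of the REVERSE process, in which "the work and heat substeps are
  interchanged" (`reverseWork`, `reverseHeat`: switch `Ê(s) → Ê(s+1)` at the current state, then
  move), with `reverseWork_reversePath` / `reverseHeat_reversePath`: **`𝒲[x] = −𝒲̂[x̂]`,
  `𝒬[x] = −𝒬̂[x̂]`** ("the heat, total work and dissipative work are all odd under a time reversal");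
* **(12) MICROSCOPIC REVERSIBILITY** `Crooks2000_eq_12`:
  **`𝒫[x | x(0), M] = 𝒫̂[x̂ | x̂(0), M̂] · e^{−β𝒬[x]}`** — for ANY positive weights the algebra is
  the telescoping `Π_t π(t)_{x(t+1)}/π(t)_{x(t)}` of p. 6; balance is what makes `M̂` stochastic;
* §III **(13)** `Crooks2000_eq_13`: `ρ(x(0)|β,E(0)) 𝒫[x|x(0),M] = e^{+β𝒲_d[x]} ρ(x̂(0)|β,Ê(0))
  𝒫̂[x̂|x̂(0),M̂]`, `𝒲_d = 𝒲 − ΔF`, `ΔF = F(β,E(τ)) − F(β,E(0))`;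
* **(1) THE PATH-ENSEMBLE AVERAGE** `Crooks2000_eq_1`: **`⟨ℱ⟩_F = ⟨ℱ̂ e^{−β𝒲_d}⟩_R`** with
  `ℱ̂[x̂] = ℱ[x]`, both sides written out as the sums over all paths of p. 7 (the reverse ensemble
  starts in the canonical law of `Ê(0) = E(τ)` and moves with `M̂`, its dissipative work being
  `𝒲̂ − ΔF̂`, `ΔF̂ = −ΔF`), and **(14)** `Crooks2000_eq_14`: `⟨ℱ e^{−β𝒲_d}⟩_F = ⟨ℱ̂⟩_R`;
* §III.A **(15)–(16) JARZYNSKI** `Crooks2000_eq_15` (`⟨e^{−β𝒲_d}⟩ = 1`) and `Crooks2000_eq_16`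
  (**`⟨e^{−β𝒲}⟩ = e^{−βΔF}`**, `= Z(β,E(τ))/Z(β,E(0))`);
* §III.B **(19) TRANSIENT FLUCTUATION THEOREM** `Crooks2000_eq_19`:
  **`P_F(+β𝒲_d) e^{−β𝒲_d} = P_R(−β𝒲_d)`** (for every value `a`, the forward probability that
  `β𝒲_d = a`, times `e^{−a}`, equals the reverse probability that `β𝒲̂_d = −a`);
* §III.C **(20)** `Crooks2000_eq_20` (`⟨f(x(τ)) e^{−β𝒲_d}⟩_neq = ⟨f⟩_eq`, the equilibrium average
  at the final energies) and **(21) KAWASAKI** `Crooks2000_eq_21`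
  (`⟨f(x(τ))⟩_F = ⟨f(x̂(0)) e^{−β𝒲_d}⟩_R`).
[cite: Crooks2000, §II eqs. (2)–(12); §III eqs. (1), (13)–(16), (19)–(21)]

Hypotheses, as printed: `β ≠ 0` wherever `F = −β⁻¹ ln Z` enters; each `K t` a transition matrix
(`IsRowStochastic`) that preserves the canonical law of `E t` (`IsStationary`) — "it is not
necessary [to impose detailed balance]. It is sufficient that the transition matrices are
balanced".  SCOPE / `TODO(general form)`: eqs. (17)–(18) (Bennett's acceptance ratio), (22)–(23)
and §IV (continuous time) are not treated.  Context (cell pub-lqcd): this is the finite-state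
theorem behind non-equilibrium (Jarzynski / NE-MCMC) evolutions in the coupling used against
topological freezing; the venture's `Exactness/NCMCGeneralSpace.lean` takes Crooks' identity as the
hypothesis `CrooksPair` on general spaces — here it is proved in the discrete setting of the source.
-/

namespace Literature.Probability.MarkovChains

open Finset Real
open Literature.Probability.MarkovChains.ReplicaExchange (boltzmann)

noncomputable section

variable {X : Type*} [Fintype X]

/-! ## §II — the canonical ensemble (eq. (2)) -/

/-- `Z(β,E) = Σ_x e^{−βE_x}`. [cite: Crooks2000, §II eq. (2) (the denominator)] -/
def canonicalZ (β : ℝ) (E : X → ℝ) : ℝ := ∑ x, boltzmann E β x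

/-- **(2)** the canonical ensemble `ρ(x|β,E) = π_x = e^{−βE_x} / Σ_x e^{−βE_x}`.
[cite: Crooks2000, §II eq. (2)] -/
def canonicalLaw (β : ℝ) (E : X → ℝ) (x : X) : ℝ := boltzmann E β x / canonicalZ β E

/-- The Helmholtz free energy `F(β,E) = −β⁻¹ ln Σ_x exp{−βE_x}`. [cite: Crooks2000, §II (line after
eq. (2))] -/
def helmholtzF (β : ℝ) (E : X → ℝ) : ℝ := -β⁻¹ * Real.log (canonicalZ β E)

omit [Fintype X] in
/-- `e^{−βE_x} > 0`. [cite: Crooks2000, §II eq. (2)] -/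
theorem boltzmann_pos' (E : X → ℝ) (β : ℝ) (x : X) : 0 < boltzmann E β x := Real.exp_pos _

/-- `Z > 0`. [cite: Crooks2000, §II eq. (2)] -/
theorem canonicalZ_pos [Nonempty X] (β : ℝ) (E : X → ℝ) : 0 < canonicalZ β E :=
  sum_pos (fun x _ => boltzmann_pos' E β x) univ_nonempty

/-- `ρ(x|β,E) > 0`. [cite: Crooks2000, §II eq. (2)] -/
theorem canonicalLaw_pos [Nonempty X] (β : ℝ) (E : X → ℝ) (x : X) : 0 < canonicalLaw β E x :=
  div_pos (boltzmann_pos' E β x) (canonicalZ_pos β E)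

/-- `Σ_x ρ(x|β,E) = 1`. [cite: Crooks2000, §II eq. (2)] -/
theorem sum_canonicalLaw [Nonempty X] (β : ℝ) (E : X → ℝ) : ∑ x, canonicalLaw β E x = 1 := by
  simp only [canonicalLaw]
  rw [← sum_div, ← canonicalZ, div_self (canonicalZ_pos β E).ne']

/-- **(2), second form**: `ρ(x|β,E) = exp{βF − βE_x}`. [cite: Crooks2000, §II eq. (2)] -/
theorem canonicalLaw_eq_exp [Nonempty X] {β : ℝ} (hβ : β ≠ 0) (E : X → ℝ) (x : X) :
    canonicalLaw β E x = Real.exp (β * helmholtzF β E - β * E x) := by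
  rw [canonicalLaw, helmholtzF, ← mul_assoc, mul_neg, mul_inv_cancel₀ hβ, neg_one_mul,
    sub_eq_add_neg, Real.exp_add, Real.exp_neg, Real.exp_log (canonicalZ_pos β E), boltzmann,
    neg_mul_eq_neg_mul, div_eq_inv_mul, neg_mul]

/-- `e^{−βΔF} = Z(β,E₁)/Z(β,E₀)` for `ΔF = F(β,E₁) − F(β,E₀)` ("the change in free energy can be
moved outside the average since it is path independent"). [cite: Crooks2000, §III.A (between eqs.
(15) and (16))] -/
theorem exp_neg_mul_sub_helmholtzF [Nonempty X] {β : ℝ} (hβ : β ≠ 0) (E₀ E₁ : X → ℝ) :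
    Real.exp (-(β * (helmholtzF β E₁ - helmholtzF β E₀))) = canonicalZ β E₁ / canonicalZ β E₀ := by
  simp only [helmholtzF]
  rw [show -(β * (-β⁻¹ * Real.log (canonicalZ β E₁) - -β⁻¹ * Real.log (canonicalZ β E₀)))
      = Real.log (canonicalZ β E₁) - Real.log (canonicalZ β E₀) by field_simp; ring,
    Real.exp_sub, Real.exp_log (canonicalZ_pos β E₁), Real.exp_log (canonicalZ_pos β E₀)]

/-! ## §II — driven dynamics: paths, heat, work (eqs. (3)–(8)) -/

variable {τ : ℕ}

omit [Fintype X] in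
/-- The probability of the trajectory `x = (x(0),…,x(τ))` given `x(0)`, for the vector of transition
matrices `M = (M(0),…,M(τ−1))`: `𝒫[x | x(0), M] = Π_{t=0}^{τ−1} P(x(t) → x(t+1))` (the dynamics are
Markovian). [cite: Crooks2000, §II eqs. (3)–(4) and p. 6 ("expanding the path probability as a
product of single time step transition probabilities")] -/
def pathProb (K : Fin τ → Matrix X X ℝ) (x : Fin (τ + 1) → X) : ℝ :=
  ∏ t : Fin τ, K t (x t.castSucc) (x t.succ)

omit [Fintype X] in
/-- **(6)** the heat `𝒬[x] = Σ_{t=0}^{τ−1} [E(t)_{x(t+1)} − E(t)_{x(t)}]` (energy entering the system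
during the stochastic transitions). [cite: Crooks2000, §II eq. (6)] -/
def heat (E : Fin (τ + 1) → X → ℝ) (x : Fin (τ + 1) → X) : ℝ :=
  ∑ t : Fin τ, (E t.castSucc (x t.succ) - E t.castSucc (x t.castSucc))

omit [Fintype X] in
/-- **(7)** the work `𝒲[x] = Σ_{t=0}^{τ−1} [E(t+1)_{x(t+1)} − E(t)_{x(t+1)}]` (energy change while
the state energies are switched at fixed state). [cite: Crooks2000, §II eq. (7)] -/
def work (E : Fin (τ + 1) → X → ℝ) (x : Fin (τ + 1) → X) : ℝ :=
  ∑ t : Fin τ, (E t.succ (x t.succ) - E t.castSucc (x t.succ))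

omit [Fintype X] in
/-- **(8) (first law)** `ΔE = E(τ)_{x(τ)} − E(0)_{x(0)} = 𝒲 + 𝒬`. [cite: Crooks2000, §II eq. (8)] -/
theorem Crooks2000_eq_8 (E : Fin (τ + 1) → X → ℝ) (x : Fin (τ + 1) → X) :
    E (Fin.last τ) (x (Fin.last τ)) - E 0 (x 0) = work E x + heat E x := by
  simp only [work, heat, ← sum_add_distrib]
  have h : ∀ t : Fin τ, E t.succ (x t.succ) - E t.castSucc (x t.succ)
      + (E t.castSucc (x t.succ) - E t.castSucc (x t.castSucc))
      = E t.succ (x t.succ) - E t.castSucc (x t.castSucc) := fun t => by ring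
  simp_rw [h, sum_sub_distrib]
  have h1 := Fin.sum_univ_succ (fun s : Fin (τ + 1) => E s (x s))
  have h2 := Fin.sum_univ_castSucc (fun s : Fin (τ + 1) => E s (x s))
  linarith

/-! ## §II — time reversal (eqs. (9)–(11)) -/

omit [Fintype X] in
/-- The time-reversed trajectory `x̂(t) = x(τ−t)` ("a simple reordering of the forward trajectory").
[cite: Crooks2000, §II (paragraph before eq. (9))] -/
def reversePath (x : Fin (τ + 1) → X) : Fin (τ + 1) → X := fun t => x (Fin.rev t)

omit [Fintype X] in
/-- The time-reversed energies `Ê(t) = E(τ−t)`. [cite: Crooks2000, §II (paragraph before eq. (9))] -/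
def reverseEnergies (E : Fin (τ + 1) → X → ℝ) : Fin (τ + 1) → X → ℝ := fun t => E (Fin.rev t)

omit [Fintype X] in
/-- `x̂(t) = x(τ−t)`. [cite: Crooks2000, §II (paragraph before eq. (9))] -/
@[simp] theorem reversePath_apply (x : Fin (τ + 1) → X) (t : Fin (τ + 1)) :
    reversePath x t = x (Fin.rev t) := rfl

omit [Fintype X] in
/-- `Ê(t) = E(τ−t)`. [cite: Crooks2000, §II (paragraph before eq. (9))] -/
@[simp] theorem reverseEnergies_apply (E : Fin (τ + 1) → X → ℝ) (t : Fin (τ + 1)) :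
    reverseEnergies E t = E (Fin.rev t) := rfl

omit [Fintype X] in
/-- Time reversal of paths is an involution. [cite: Crooks2000, §III ("The set of reverse
trajectories is the same as the set of forward trajectories")] -/
theorem reversePath_reversePath (x : Fin (τ + 1) → X) : reversePath (reversePath x) = x :=
  funext fun t => by simp [Fin.rev_rev]

omit [Fintype X] in
/-- `Ê` reversed again is `E`. [cite: Crooks2000, §II] -/
theorem reverseEnergies_reverseEnergies (E : Fin (τ + 1) → X → ℝ) :
    reverseEnergies (reverseEnergies E) = E :=
  funext fun t => by simp [Fin.rev_rev]

/-- **(10)** the time reversal of the vector of transition matrices: the reverse step `s`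
(reverse time `s → s+1`, i.e. forward time `τ−s → τ−1−s`) is the time reversal — w.r.t. the canonical
law of the energies `E(τ−1−s)` in force during that forward move — of the forward matrix
`M(τ−1−s)`: "the time reversal operation is applied to each transition matrix, and their time order
is reversed". [cite: Crooks2000, §II eqs. (9)–(11)] -/
def reverseProtocol (β : ℝ) (E : Fin (τ + 1) → X → ℝ) (K : Fin τ → Matrix X X ℝ) :
    Fin τ → Matrix X X ℝ :=
  fun s => timeReversal (boltzmann (E (Fin.rev s).castSucc) β) (K (Fin.rev s))

/-- "It is easy to confirm that `M̂` is a transition matrix": nonnegative entries and unit row sums,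
given that `M` is one and is balanced. [cite: Crooks2000, §II (after eq. (9))] -/
theorem reverseProtocol_isRowStochastic {β : ℝ} {E : Fin (τ + 1) → X → ℝ}
    {K : Fin τ → Matrix X X ℝ} (hK : ∀ t, IsRowStochastic (K t))
    (hst : ∀ t : Fin τ, IsStationary (boltzmann (E t.castSucc) β) (K t)) (s : Fin τ) :
    IsRowStochastic (reverseProtocol β E K s) :=
  timeReversal_isRowStochastic (fun x => boltzmann_pos' _ _ x) (hK _) (hst _)

/-- "`M̂` and `M` have the same invariant distribution." [cite: Crooks2000, §II (after eq. (9))] -/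
theorem reverseProtocol_isStationary {β : ℝ} {E : Fin (τ + 1) → X → ℝ}
    {K : Fin τ → Matrix X X ℝ} (hK : ∀ t, IsRowStochastic (K t)) (s : Fin τ) :
    IsStationary (boltzmann (E (Fin.rev s).castSucc) β) (reverseProtocol β E K s) :=
  LevinPeres2017_prop_1_23_stationary (fun x => (boltzmann_pos' _ _ x).ne') (hK _).2

omit [Fintype X] in
/-- "If the transition matrix obeys detailed balance, Eq. (5), then `M̂ = M`" (with the time order
reversed). [cite: Crooks2000, §II eq. (5) and the sentence after eq. (9)] -/
theorem reverseProtocol_eq_of_detailedBalance [DecidableEq X] {β : ℝ} {E : Fin (τ + 1) → X → ℝ}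
    {K : Fin τ → Matrix X X ℝ}
    (hDB : ∀ t : Fin τ, DetailedBalance (boltzmann (E t.castSucc) β) (K t)) (s : Fin τ) :
    reverseProtocol β E K s = K (Fin.rev s) :=
  timeReversal_eq_self_of_detailedBalance (fun x => (boltzmann_pos' _ _ x).ne') (hDB _)

omit [Fintype X] in
/-- The work of the REVERSE process, in which "the work and heat substeps are interchanged": at
reverse step `s` the energies switch `Ê(s) → Ê(s+1)` at the current state `y(s)`, then the system
moves. [cite: Crooks2000, §II (paragraph after eq. (11))] -/
def reverseWork (Eh : Fin (τ + 1) → X → ℝ) (y : Fin (τ + 1) → X) : ℝ :=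
  ∑ s : Fin τ, (Eh s.succ (y s.castSucc) - Eh s.castSucc (y s.castSucc))

omit [Fintype X] in
/-- The heat of the REVERSE process (the move at reverse step `s` happens at the energies `Ê(s+1)`).
[cite: Crooks2000, §II (paragraph after eq. (11))] -/
def reverseHeat (Eh : Fin (τ + 1) → X → ℝ) (y : Fin (τ + 1) → X) : ℝ :=
  ∑ s : Fin τ, (Eh s.succ (y s.succ) - Eh s.succ (y s.castSucc))

omit [Fintype X] in
/-- **The work is odd under time reversal**: `𝒲[x] = −𝒲̂[x̂]`. [cite: Crooks2000, §II ("The heat,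
total work and dissipative work are all odd under a time reversal")] -/
theorem reverseWork_reversePath (E : Fin (τ + 1) → X → ℝ) (x : Fin (τ + 1) → X) :
    reverseWork (reverseEnergies E) (reversePath x) = -work E x := by
  simp only [reverseWork, work, reversePath_apply, reverseEnergies_apply, Fin.rev_succ,
    Fin.rev_castSucc]
  rw [← Equiv.sum_comp Fin.revPerm, ← sum_neg_distrib]
  exact sum_congr rfl fun t _ => by simp [Fin.revPerm_apply]

omit [Fintype X] in
/-- **The heat is odd under time reversal**: `𝒬[x] = −𝒬̂[x̂]`. [cite: Crooks2000, §II ("The heat,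
total work and dissipative work are all odd under a time reversal")] -/
theorem reverseHeat_reversePath (E : Fin (τ + 1) → X → ℝ) (x : Fin (τ + 1) → X) :
    reverseHeat (reverseEnergies E) (reversePath x) = -heat E x := by
  simp only [reverseHeat, heat, reversePath_apply, reverseEnergies_apply, Fin.rev_succ,
    Fin.rev_castSucc]
  rw [← Equiv.sum_comp Fin.revPerm, ← sum_neg_distrib]
  exact sum_congr rfl fun t _ => by simp [Fin.revPerm_apply]

/-! ## §II — microscopic reversibility (eq. (12)) -/

omit [Fintype X] in
/-- **(12) MICROSCOPIC REVERSIBILITY**: `𝒫[x | x(0), M] / 𝒫̂[x̂ | x̂(0), M̂] = exp{−β𝒬[x]}`, in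
product form.  The proof is the printed one: the ratio "can be converted into a product of
equilibrium probabilities" `Π_t π(t)_{x(t+1)}/π(t)_{x(t)} = exp{−βΣ_t[E(t)_{x(t+1)} − E(t)_{x(t)}]}`.
[cite: Crooks2000, §II eq. (12) and its proof (p. 6)] -/
theorem Crooks2000_eq_12 (β : ℝ) (E : Fin (τ + 1) → X → ℝ) (K : Fin τ → Matrix X X ℝ)
    (x : Fin (τ + 1) → X) :
    pathProb K x
      = pathProb (reverseProtocol β E K) (reversePath x) * Real.exp (-(β * heat E x)) := by
  -- the reverse path probability, re-indexed along the forward time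
  have hrev : pathProb (reverseProtocol β E K) (reversePath x)
      = ∏ t : Fin τ, boltzmann (E t.castSucc) β (x t.castSucc) * K t (x t.castSucc) (x t.succ)
          / boltzmann (E t.castSucc) β (x t.succ) := by
    simp only [pathProb, reverseProtocol, reversePath_apply, timeReversal_apply, Fin.rev_succ,
      Fin.rev_castSucc]
    rw [← Equiv.prod_comp Fin.revPerm]
    exact prod_congr rfl fun t _ => by simp [Fin.revPerm_apply]
  -- `exp{−β𝒬}` as the product of the Boltzmann ratios
  have hheat : Real.exp (-(β * heat E x))
      = ∏ t : Fin τ, boltzmann (E t.castSucc) β (x t.succ) / boltzmann (E t.castSucc) β (x t.castSucc) := by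
    rw [heat, mul_sum, ← sum_neg_distrib, Real.exp_sum]
    refine prod_congr rfl fun t _ => ?_
    rw [boltzmann, boltzmann, ← Real.exp_sub]
    congr 1
    ring
  rw [hrev, hheat, ← prod_mul_distrib, pathProb]
  refine prod_congr rfl fun t _ => ?_
  have h1 := (boltzmann_pos' (E t.castSucc) β (x t.castSucc)).ne'
  have h2 := (boltzmann_pos' (E t.castSucc) β (x t.succ)).ne'
  field_simp

/-! ## §III — path-ensemble averages (eqs. (13), (1), (14)) -/

variable [Nonempty X]

/-- **(13)**: `ρ(x(0)|β,E(0)) 𝒫[x|x(0),M] / (ρ(x̂(0)|β,Ê(0)) 𝒫̂[x̂|x̂(0),M̂]) = e^{βΔE − βΔF − β𝒬}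
= e^{β𝒲 − βΔF} = e^{+β𝒲_d[x]}`, in product form (`x̂(0) = x(τ)`, `Ê(0) = E(τ)`).
[cite: Crooks2000, §III eq. (13)] -/
theorem Crooks2000_eq_13 {β : ℝ} (hβ : β ≠ 0) (E : Fin (τ + 1) → X → ℝ)
    (K : Fin τ → Matrix X X ℝ) (x : Fin (τ + 1) → X) :
    canonicalLaw β (E 0) (x 0) * pathProb K x
      = Real.exp (β * (work E x - (helmholtzF β (E (Fin.last τ)) - helmholtzF β (E 0))))
        * (canonicalLaw β (reverseEnergies E 0) (reversePath x 0)
          * pathProb (reverseProtocol β E K) (reversePath x)) := by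
  rw [Crooks2000_eq_12 β E K x, reversePath_apply, reverseEnergies_apply, Fin.rev_zero,
    canonicalLaw_eq_exp hβ, canonicalLaw_eq_exp hβ]
  have h8 := Crooks2000_eq_8 E x
  -- collect the exponentials on both sides
  rw [show Real.exp (β * helmholtzF β (E 0) - β * E 0 (x 0))
        * (pathProb (reverseProtocol β E K) (reversePath x) * Real.exp (-(β * heat E x)))
      = pathProb (reverseProtocol β E K) (reversePath x)
        * Real.exp (β * helmholtzF β (E 0) - β * E 0 (x 0) + -(β * heat E x)) by
        rw [Real.exp_add]; ring,
    show Real.exp (β * (work E x - (helmholtzF β (E (Fin.last τ)) - helmholtzF β (E 0))))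
        * (Real.exp (β * helmholtzF β (E (Fin.last τ)) - β * E (Fin.last τ) (x (Fin.last τ)))
          * pathProb (reverseProtocol β E K) (reversePath x))
      = pathProb (reverseProtocol β E K) (reversePath x)
        * Real.exp (β * (work E x - (helmholtzF β (E (Fin.last τ)) - helmholtzF β (E 0)))
          + (β * helmholtzF β (E (Fin.last τ)) - β * E (Fin.last τ) (x (Fin.last τ)))) by
        rw [Real.exp_add]; ring]
  congr 2
  linear_combination β * h8

/-- The dissipative work `𝒲_d[x] = 𝒲[x] − W_r`, `W_r = ΔF = F(β,E(τ)) − F(β,E(0))`.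
[cite: Crooks2000, §II (first paragraph of p. 5: "The dissipative work … is defined as the difference
between the actual work and the reversible work")] -/
def dissWork (β : ℝ) (E : Fin (τ + 1) → X → ℝ) (x : Fin (τ + 1) → X) : ℝ :=
  work E x - (helmholtzF β (E (Fin.last τ)) - helmholtzF β (E 0))

/-- The dissipative work of the REVERSE process: `𝒲̂_d[y] = 𝒲̂[y] − ΔF̂`, `ΔF̂ = F(β,Ê(τ)) − F(β,Ê(0))
= −ΔF`. [cite: Crooks2000, §II (p. 5) with the reverse process of eqs. (9)–(11)] -/
def reverseDissWork (β : ℝ) (E : Fin (τ + 1) → X → ℝ) (y : Fin (τ + 1) → X) : ℝ :=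
  reverseWork (reverseEnergies E) y
    - (helmholtzF β (reverseEnergies E (Fin.last τ)) - helmholtzF β (reverseEnergies E 0))

omit [Nonempty X] in
/-- **The dissipative work is odd under time reversal**: `𝒲_d[x] = −𝒲̂_d[x̂]`.
[cite: Crooks2000, §II ("The heat, total work and dissipative work are all odd under a time
reversal")] -/
theorem reverseDissWork_reversePath (β : ℝ) (E : Fin (τ + 1) → X → ℝ) (x : Fin (τ + 1) → X) :
    reverseDissWork β E (reversePath x) = -dissWork β E x := by
  rw [reverseDissWork, dissWork, reverseWork_reversePath, reverseEnergies_apply,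
    reverseEnergies_apply, Fin.rev_last, Fin.rev_zero]
  ring

omit [Nonempty X] in
/-- The FORWARD path ensemble: "the probability of a trajectory is determined by the equilibrium
probability of the initial state, and by the vector of transition matrices",
`ρ(x(0)|β,E(0)) 𝒫[x | x(0), M]`. [cite: Crooks2000, §III (the display before eq. (13))] -/
def forwardWeight (β : ℝ) (E : Fin (τ + 1) → X → ℝ) (K : Fin τ → Matrix X X ℝ)
    (x : Fin (τ + 1) → X) : ℝ :=
  canonicalLaw β (E 0) (x 0) * pathProb K x

omit [Nonempty X] in
/-- The REVERSE path ensemble: it "too starts from equilibrium" (in the canonical law of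
`Ê(0) = E(τ)`) and moves with `M̂`: `ρ(x̂(0)|β,Ê(0)) 𝒫̂[x̂ | x̂(0), M̂]`. [cite: Crooks2000, §I
(construction of the reverse process) and §III eq. (13) (the denominator)] -/
def reverseWeight (β : ℝ) (E : Fin (τ + 1) → X → ℝ) (K : Fin τ → Matrix X X ℝ)
    (y : Fin (τ + 1) → X) : ℝ :=
  canonicalLaw β (reverseEnergies E 0) (y 0) * pathProb (reverseProtocol β E K) y

/-- **(13)** in the path-ensemble vocabulary: `ρ(x(0)|β,E(0)) 𝒫[x|x(0),M]
= e^{+β𝒲_d[x]} · ρ(x̂(0)|β,Ê(0)) 𝒫̂[x̂|x̂(0),M̂]`. [cite: Crooks2000, §III eq. (13)] -/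
theorem forwardWeight_eq {β : ℝ} (hβ : β ≠ 0) (E : Fin (τ + 1) → X → ℝ)
    (K : Fin τ → Matrix X X ℝ) (x : Fin (τ + 1) → X) :
    forwardWeight β E K x
      = Real.exp (β * dissWork β E x) * reverseWeight β E K (reversePath x) := by
  rw [forwardWeight, Crooks2000_eq_13 hβ, reverseWeight, dissWork, reversePath_apply]

omit [Nonempty X] in
/-- Summing a path function over all paths is summing it over all reversed paths (time reversal is
a bijection of the set of trajectories). [cite: Crooks2000, §III ("The set of reverse trajectories
is the same as the set of forward trajectories")] -/
theorem sum_reversePath (G : (Fin (τ + 1) → X) → ℝ) :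
    ∑ x : Fin (τ + 1) → X, G (reversePath x) = ∑ x : Fin (τ + 1) → X, G x :=
  Fintype.sum_bijective reversePath
    (Function.Involutive.bijective fun x => reversePath_reversePath x) _ _ fun _ => rfl

/-- **(1) THE PATH-ENSEMBLE AVERAGE**: `⟨ℱ⟩_F = ⟨ℱ̂ e^{−β𝒲_d}⟩_R`, where `ℱ̂[x̂] = ℱ[x]` and the
reverse average is over the reverse ensemble with its own dissipative work `𝒲̂_d`; both averages
are written out as sums over all trajectories, as in the two displays of p. 7.
[cite: Crooks2000, §I eq. (1); §III (proof, p. 7)] -/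
theorem Crooks2000_eq_1 {β : ℝ} (hβ : β ≠ 0) (E : Fin (τ + 1) → X → ℝ)
    (K : Fin τ → Matrix X X ℝ) (F : (Fin (τ + 1) → X) → ℝ) :
    ∑ x : Fin (τ + 1) → X, forwardWeight β E K x * F x
      = ∑ y : Fin (τ + 1) → X, reverseWeight β E K y *
          (F (reversePath y) * Real.exp (-(β * reverseDissWork β E y))) := by
  rw [← sum_reversePath (fun y => reverseWeight β E K y *
    (F (reversePath y) * Real.exp (-(β * reverseDissWork β E y))))]
  refine sum_congr rfl fun x _ => ?_
  simp only [reversePath_reversePath, reverseDissWork_reversePath, forwardWeight_eq hβ]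
  rw [mul_neg, neg_neg]
  ring

/-- **(14)**: `⟨ℱ e^{−β𝒲_d}⟩_F = ⟨ℱ̂⟩_R`. [cite: Crooks2000, §III eq. (14)] -/
theorem Crooks2000_eq_14 {β : ℝ} (hβ : β ≠ 0) (E : Fin (τ + 1) → X → ℝ)
    (K : Fin τ → Matrix X X ℝ) (F : (Fin (τ + 1) → X) → ℝ) :
    ∑ x : Fin (τ + 1) → X, forwardWeight β E K x * (F x * Real.exp (-(β * dissWork β E x)))
      = ∑ y : Fin (τ + 1) → X, reverseWeight β E K y * F (reversePath y) := by
  rw [← sum_reversePath (fun y => reverseWeight β E K y * F (reversePath y))]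
  refine sum_congr rfl fun x _ => ?_
  simp only [reversePath_reversePath, forwardWeight_eq hβ]
  rw [show Real.exp (β * dissWork β E x) * reverseWeight β E K (reversePath x)
        * (F x * Real.exp (-(β * dissWork β E x)))
      = reverseWeight β E K (reversePath x) * F x
        * (Real.exp (β * dissWork β E x) * Real.exp (-(β * dissWork β E x))) by ring,
    ← Real.exp_add, add_neg_cancel, Real.exp_zero, mul_one]

/-! ## Normalisation of the path ensembles -/

omit [Nonempty X] [Fintype X] in
/-- The path probability of a trajectory through its first step:
`𝒫[(a, y) | a, M] = M(0)(a → y(0)) · 𝒫[y | y(0), (M(1),…)]`. [cite: Crooks2000, §II eqs. (3)–(4)] -/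
theorem pathProb_cons (L : Fin (τ + 1) → Matrix X X ℝ) (a : X) (y : Fin (τ + 1) → X) :
    pathProb L (Fin.cons a y : Fin (τ + 2) → X) = L 0 a (y 0) * pathProb (fun t => L t.succ) y := by
  rw [pathProb, Fin.prod_univ_succ, pathProb]
  have h1 : ∀ t : Fin τ, (Fin.cons a y : Fin (τ + 2) → X) t.succ.castSucc = y t.castSucc :=
    fun t => by rw [← Fin.succ_castSucc, Fin.cons_succ]
  simp only [Fin.castSucc_zero, Fin.cons_zero, Fin.cons_succ, h1]

omit [Nonempty X] in
/-- A path ensemble started from the weights `g` and moved by transition matrices has total weight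
`Σ_z g(z)` ("normalization of probability distributions"). [cite: Crooks2000, §III.A (the sentence
after eq. (15))] -/
theorem sum_mul_pathProb :
    ∀ (τ : ℕ) (L : Fin τ → Matrix X X ℝ) (_hL : ∀ t x, ∑ y, L t x y = 1) (g : X → ℝ),
      ∑ y : Fin (τ + 1) → X, g (y 0) * pathProb L y = ∑ z, g z := by
  intro τ
  induction τ with
  | zero =>
      intro L _ g
      simp only [pathProb, univ_eq_empty, prod_empty, mul_one]
      exact Fintype.sum_equiv (Equiv.funUnique (Fin 1) X) _ _ fun y => rfl
  | succ τ ih =>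
      intro L hL g
      rw [← Fintype.sum_equiv (Fin.consEquiv fun _ => X)
        (fun q : X × (Fin (τ + 1) → X) => g q.1 * pathProb L (Fin.cons q.1 q.2))
        (fun y => g (y 0) * pathProb L y) (fun q => by simp [Fin.consEquiv]),
        Fintype.sum_prod_type]
      refine sum_congr rfl fun a _ => ?_
      simp only [pathProb_cons]
      rw [← mul_sum, ih (fun t => L t.succ) (fun t x => hL t.succ x) (fun z => L 0 a z), hL 0 a,
        mul_one]

/-- The forward path ensemble is a probability: `Σ_x ρ(x(0)|β,E(0)) 𝒫[x|x(0),M] = 1`.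
[cite: Crooks2000, §III.A ("normalization of probability distributions")] -/
theorem sum_forwardWeight (β : ℝ) (E : Fin (τ + 1) → X → ℝ) {K : Fin τ → Matrix X X ℝ}
    (hK : ∀ t, IsRowStochastic (K t)) : ∑ x : Fin (τ + 1) → X, forwardWeight β E K x = 1 := by
  simp only [forwardWeight]
  rw [sum_mul_pathProb τ K (fun t x => (hK t).2 x) (canonicalLaw β (E 0)), sum_canonicalLaw]

/-- The reverse path ensemble is a probability: `⟨1⟩_R = 1` (here the balance of each `M(t)` enters,
through the unit row sums of `M̂`). [cite: Crooks2000, §III.A eq. (15) ("The right side is unity due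
to normalization of probability distributions")] -/
theorem sum_reverseWeight (β : ℝ) {E : Fin (τ + 1) → X → ℝ} {K : Fin τ → Matrix X X ℝ}
    (hK : ∀ t, IsRowStochastic (K t))
    (hst : ∀ t : Fin τ, IsStationary (boltzmann (E t.castSucc) β) (K t)) :
    ∑ y : Fin (τ + 1) → X, reverseWeight β E K y = 1 := by
  simp only [reverseWeight]
  rw [sum_mul_pathProb τ (reverseProtocol β E K)
    (fun s x => (reverseProtocol_isRowStochastic hK hst s).2 x)
    (canonicalLaw β (reverseEnergies E 0)), sum_canonicalLaw]

/-! ## §III.A — the Jarzynski nonequilibrium work relation (eqs. (15)–(16)) -/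

/-- **(15)**: `⟨e^{−β𝒲_d}⟩_F = ⟨1⟩_R = 1`. [cite: Crooks2000, §III.A eq. (15)] -/
theorem Crooks2000_eq_15 {β : ℝ} (hβ : β ≠ 0) {E : Fin (τ + 1) → X → ℝ}
    {K : Fin τ → Matrix X X ℝ} (hK : ∀ t, IsRowStochastic (K t))
    (hst : ∀ t : Fin τ, IsStationary (boltzmann (E t.castSucc) β) (K t)) :
    ∑ x : Fin (τ + 1) → X, forwardWeight β E K x * Real.exp (-(β * dissWork β E x)) = 1 := by
  have h := Crooks2000_eq_14 hβ E K (fun _ => 1)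
  simp only [one_mul, mul_one] at h
  rw [h, sum_reverseWeight β hK hst]

/-- **(16) THE JARZYNSKI NONEQUILIBRIUM WORK RELATION**: `⟨e^{−β𝒲}⟩ = e^{−βΔF}`.
[cite: Crooks2000, §III.A eq. (16)] -/
theorem Crooks2000_eq_16 {β : ℝ} (hβ : β ≠ 0) {E : Fin (τ + 1) → X → ℝ}
    {K : Fin τ → Matrix X X ℝ} (hK : ∀ t, IsRowStochastic (K t))
    (hst : ∀ t : Fin τ, IsStationary (boltzmann (E t.castSucc) β) (K t)) :
    ∑ x : Fin (τ + 1) → X, forwardWeight β E K x * Real.exp (-(β * work E x))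
      = Real.exp (-(β * (helmholtzF β (E (Fin.last τ)) - helmholtzF β (E 0)))) := by
  have h := Crooks2000_eq_15 hβ hK hst
  have hsplit : ∀ x : Fin (τ + 1) → X, Real.exp (-(β * work E x))
      = Real.exp (-(β * dissWork β E x))
        * Real.exp (-(β * (helmholtzF β (E (Fin.last τ)) - helmholtzF β (E 0)))) := by
    intro x
    rw [← Real.exp_add, dissWork]
    congr 1
    ring
  simp_rw [hsplit, ← mul_assoc, ← sum_mul, h, one_mul]

/-- **(16), free-energy form**: `⟨e^{−β𝒲}⟩ = Z(β,E(τ))/Z(β,E(0))` — "the change in the free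
energies of the corresponding equilibrium ensembles can be calculated by repeating the switching
process many times, each time starting from an equilibrium ensemble".
[cite: Crooks2000, §III.A eq. (16) and the paragraph after it] -/
theorem Crooks2000_eq_16_ratio {β : ℝ} (hβ : β ≠ 0) {E : Fin (τ + 1) → X → ℝ}
    {K : Fin τ → Matrix X X ℝ} (hK : ∀ t, IsRowStochastic (K t))
    (hst : ∀ t : Fin τ, IsStationary (boltzmann (E t.castSucc) β) (K t)) :
    ∑ x : Fin (τ + 1) → X, forwardWeight β E K x * Real.exp (-(β * work E x))
      = canonicalZ β (E (Fin.last τ)) / canonicalZ β (E 0) := by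
  rw [Crooks2000_eq_16 hβ hK hst, exp_neg_mul_sub_helmholtzF hβ]

/-! ## §III.B — the transient fluctuation theorem (eq. (19)) -/

/-- **(19) THE TRANSIENT (WORK) FLUCTUATION THEOREM**:
`P_F(+β𝒲_d) e^{−β𝒲_d} = P_R(−β𝒲_d)` — for every value `a`, the probability under the forward
process that `β𝒲_d = a`, times `e^{−a}`, equals the probability under the reverse process that its
own `β𝒲̂_d` equals `−a` ("the probability of expending the negative of that amount of work in the
reverse process"); eq. (19) is this identity divided by `P_R(−β𝒲_d) ≠ 0`.
[cite: Crooks2000, §III.B eq. (19) and the display before it] -/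
theorem Crooks2000_eq_19 [DecidableEq X] {β : ℝ} (hβ : β ≠ 0) (E : Fin (τ + 1) → X → ℝ)
    (K : Fin τ → Matrix X X ℝ) (a : ℝ) :
    (∑ x ∈ (univ : Finset (Fin (τ + 1) → X)).filter (fun x => β * dissWork β E x = a),
        forwardWeight β E K x) * Real.exp (-a)
      = ∑ y ∈ (univ : Finset (Fin (τ + 1) → X)).filter (fun y => β * reverseDissWork β E y = -a),
          reverseWeight β E K y := by
  have h := Crooks2000_eq_14 hβ E K (fun x => if β * dissWork β E x = a then 1 else 0)
  have hL : (∑ x ∈ (univ : Finset (Fin (τ + 1) → X)).filter (fun x => β * dissWork β E x = a),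
        forwardWeight β E K x) * Real.exp (-a)
      = ∑ x : Fin (τ + 1) → X, forwardWeight β E K x *
          ((if β * dissWork β E x = a then 1 else 0) * Real.exp (-(β * dissWork β E x))) := by
    rw [sum_filter, sum_mul]
    refine sum_congr rfl fun x _ => ?_
    by_cases hx : β * dissWork β E x = a
    · rw [if_pos hx, if_pos hx, one_mul, hx]
    · rw [if_neg hx, if_neg hx, zero_mul, zero_mul, mul_zero]
  have hR : ∑ y ∈ (univ : Finset (Fin (τ + 1) → X)).filter (fun y => β * reverseDissWork β E y = -a),
        reverseWeight β E K y
      = ∑ y : Fin (τ + 1) → X, reverseWeight β E K y *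
          (if β * dissWork β E (reversePath y) = a then 1 else 0) := by
    rw [sum_filter]
    refine sum_congr rfl fun y _ => ?_
    have hodd : reverseDissWork β E y = -dissWork β E (reversePath y) := by
      have h' := reverseDissWork_reversePath β E (reversePath y)
      rwa [reversePath_reversePath] at h'
    rw [hodd, mul_neg]
    by_cases hy : β * dissWork β E (reversePath y) = a
    · rw [if_pos (show -(β * dissWork β E (reversePath y)) = -a by rw [hy]), if_pos hy, mul_one]
    · rw [if_neg (fun h' => hy (neg_inj.1 h')), if_neg hy, mul_zero]
  rw [hL, hR, h]

/-! ## §III.C — Kawasaki response and nonequilibrium distributions (eqs. (20)–(21)) -/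

/-- **(20)**: `⟨f(x(τ)) e^{−β𝒲_d}⟩_neq = ⟨f(x(τ))⟩_eq` — "the average of a state function in a
nonequilibrium ensemble, weighted by the dissipative work, can be equated with an equilibrium
average of the same quantity" (the equilibrium average at the final energies `E(τ)`; "in the reverse
process the average is over the initial equilibrium ensemble of the system, and the subsequent
dynamics are irrelevant"). [cite: Crooks2000, §III.C eq. (20) and the display before it] -/
theorem Crooks2000_eq_20 {β : ℝ} (hβ : β ≠ 0) {E : Fin (τ + 1) → X → ℝ}
    {K : Fin τ → Matrix X X ℝ} (hK : ∀ t, IsRowStochastic (K t))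
    (hst : ∀ t : Fin τ, IsStationary (boltzmann (E t.castSucc) β) (K t)) (f : X → ℝ) :
    ∑ x : Fin (τ + 1) → X, forwardWeight β E K x
        * (f (x (Fin.last τ)) * Real.exp (-(β * dissWork β E x)))
      = ∑ z, canonicalLaw β (E (Fin.last τ)) z * f z := by
  rw [Crooks2000_eq_14 hβ E K (fun x => f (x (Fin.last τ)))]
  simp only [reversePath_apply, Fin.rev_last, reverseWeight]
  simp_rw [mul_assoc, mul_comm (pathProb _ _), ← mul_assoc]
  rw [sum_mul_pathProb τ (reverseProtocol β E K)
    (fun s x => (reverseProtocol_isRowStochastic hK hst s).2 x)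
    (fun z => canonicalLaw β (reverseEnergies E 0) z * f z)]
  simp [Fin.rev_zero]

/-- **(21) THE KAWASAKI NONLINEAR RESPONSE RELATION**: `⟨f(x(τ))⟩_F = ⟨f(x̂(0)) e^{−β𝒲_d}⟩_R`.
[cite: Crooks2000, §III.C eq. (21)] -/
theorem Crooks2000_eq_21 {β : ℝ} (hβ : β ≠ 0) (E : Fin (τ + 1) → X → ℝ)
    (K : Fin τ → Matrix X X ℝ) (f : X → ℝ) :
    ∑ x : Fin (τ + 1) → X, forwardWeight β E K x * f (x (Fin.last τ))
      = ∑ y : Fin (τ + 1) → X, reverseWeight β E K y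
          * (f (y 0) * Real.exp (-(β * reverseDissWork β E y))) := by
  rw [Crooks2000_eq_1 hβ E K (fun x => f (x (Fin.last τ)))]
  simp [Fin.rev_last]

end

end Literature.Probability.MarkovChains
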